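import Mathlib
import HarnessLib
import Literature.MathematicalPhysics.QuantumFieldTheory.GaussianCovarianceComparisonVector
import Literature.MathematicalPhysics.StatisticalMechanics.StepMeasureScaling
import Literature.MathematicalPhysics.StatisticalMechanics.StepKernelBoundsABKM

/-!
# Lipschitz dependence of the integration map on the step kernel in the Taylor norms:
# `‖R_{𝒞a}K − R_{𝒞b}K‖_{T, w_{k:k+1}^X} ≤ ℓ · δ · ‖K‖_{T, w_k^X}` ([ABKM19] Lemma 8.4, `ℓ = 1`)

[ABKM19] Lemma 8.4 with `ℓ = 1` (the `q`-derivative of `R^{(q)}_{k+1}`, needed for the fine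
tuning of Ch. 12) is obtained here in the crude, volume-DEPENDENT form that the Brouwer version
of Lemma 12.6 (`RGFlow.exists_isTunedQ_initial_eq_of_finiteDimensional`) tolerates: for two step
kernels `𝒞a, 𝒞b` (even, zero sum, multipliers positive off the zero mode) whose multipliers are
`δ`-close, `|Re 𝒞̂a − Re 𝒞̂b| ≤ δ Re 𝒞̂a`, and a `T`-local `C^{r₀}` functional `K` with
`‖K‖_{T, w_k^X} ≤ C`,

* **`tayNormLE_fluct_sub_fluct`** —
  `‖fluct 𝒞a K − fluct 𝒞b K‖_{T, w_{k:k+1}^X} ≤ C · (r₀+1) · gaussCompConst(M^d, q) · δ · (A𝒫p^{|X|_k})^{1/p}`,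

where `p, q` are Hölder conjugate, `δ ≤ 1/(16q)`, and `A𝒫p` is the (w7′) constant of the dilated
kernel `p·𝒞b` relative to the weights (`StepKernelBounds`, e.g. from the multiplier domination
`p · Re 𝒞̂b ≤ (1+ρ) ĉ_{k+1}`, `ρ < θ̄`).  Proof: the `s`-th derivative of the lift of
`R_{𝒞}K` is `∫ D^s K̄(Tφ + Tζ) μ_𝒞(dζ)` (`DerivDominated`, section domination); the integrand
is shift invariant (the gauge kills constants), so both expectations may be taken under the
positive definite regularisations `N(0, circulant 𝒞 + 𝟙𝟙ᵀ)` (`StepMeasureRegularisation`); the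
Banach-valued Gaussian comparison (`GaussianCovarianceComparisonVector`) with the precision
sandwich in Fourier variables bounds the difference by `δ ‖D^s K̄‖_{L^p}`, and
`‖D^s K̄(T(φ+ζ))‖ ≤ s! C w_k^X(φ+ζ)` with `∫ (w_k^X)^p dμ_{𝒞b} = ∫ w_k^X(√p φ + ·) dμ_{p𝒞b}
≤ A𝒫p^{|X|} w_{k:k+1}^X(φ)^p` (`StepMeasureScaling`).

Also: `integrable_weight_multivariateGaussian_add_constMat`,
`integral_weight_rpow_multivariateGaussian_add_constMat_le` (the weight facts under the
regularised Gaussians).  Everything is proved; no named fact.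

## References
* S. Adams, S. Buchholz, R. Kotecký, S. Müller, arXiv:1910.13564, Lemma 8.4, Theorem 6.2, Lemma 12.6
  [AdamsBuchholzKoteckyMuller2019].
* S. Buchholz, J. Funct. Anal. 275 (2018), Thm 4.5 [Buchholz2016].
-/

noncomputable section

namespace Literature.MathematicalPhysics.StatisticalMechanics.GradientRG

open scoped BigOperators Matrix ENNReal
open MeasureTheory ProbabilityTheory Finset WithLp Matrix
open Literature.MathematicalPhysics.StatisticalMechanics.GradientFRD (mulMat fourierCoeff
  re_fourierCoeff_zero_of_sum_eq_zero)
open Literature.MathematicalPhysics.StatisticalMechanics.TorusPolymer (IsPolymer numBlocks)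
open Literature.MathematicalPhysics.QuantumFieldTheory

variable {d M : ℕ} [NeZero M]

/-! ## The weights under the regularised Gaussians -/

/-- **`w_k^X(φ + ·)` is integrable under `N(0, circulant 𝒞 + c𝟙𝟙ᵀ)`** when it is under
`μ_𝒞 = N(0, circulant 𝒞)` (local dominated weights do not see the constant mode; the integral of
the positive weight is the same positive number under both measures).
[cite: AdamsBuchholzKoteckyMuller2019, Lemma 6.3 / Lemma 8.4] -/
theorem integrable_weight_multivariateGaussian_add_constMat (W : WeightData (Fin d → ZMod M))
    {nb : ℕ → Finset (Fin d → ZMod M) → Finset (Fin d → ZMod M)} (hWl : W.Local nb)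
    {Dm : ℕ → Matrix (Fin d → ZMod M) (Fin d → ZMod M) ℝ} (hD : W.Dominated Dm)
    {𝒞 : (Fin d → ZMod M) → ℝ} (hC : (Matrix.circulant 𝒞).PosSemidef) {c : ℝ} (hc : 0 ≤ c)
    (k : ℕ) (X : Finset (Fin d → ZMod M))
    (hint : ∀ φ, Integrable (fun ξ : (Fin d → ZMod M) → ℝ => W.weight k X (φ + ξ)) (stepMeasure 𝒞))
    (φ : (Fin d → ZMod M) → ℝ) :
    Integrable (fun y : EuclideanSpace ℝ (Fin d → ZMod M) => W.weight k X (φ + ofLp y))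
      (multivariateGaussian 0 (Matrix.circulant 𝒞 + constMat c)) := by
  have htr := integral_stepMeasure_eq_integral_multivariateGaussian_add_constMat hC hc
    (F := fun ξ => W.weight k X (φ + ξ)) (continuous_weight_comp_add W k X φ).stronglyMeasurable
    (fun ξ a => by
      show W.weight k X (φ + (ξ + fun _ => a)) = W.weight k X (φ + ξ)
      rw [← add_assoc, WeightData.weight_add_const hWl hD])
  haveI := isProbabilityMeasure_stepMeasure 𝒞
  have hpos : 0 < ∫ ξ, W.weight k X (φ + ξ) ∂(stepMeasure 𝒞) := by
    have hi := hint φ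
    unfold WeightData.weight at hi ⊢
    exact integral_exp_pos hi
  by_contra h
  rw [htr, integral_undef h] at hpos
  exact lt_irrefl _ hpos

/-- **The `p`-th power of the weight under the reference regularised Gaussian**: if the dilated
kernel `p·𝒞` satisfies `StepKernelBounds` with (w7′)-constant `A𝒫p`, then
`y ↦ w_k^X(φ + y)^p` is `N(0, circulant 𝒞 + c𝟙𝟙ᵀ)`-integrable and
`∫ w_k^X(φ + y)^p dN(0, circulant 𝒞 + c𝟙𝟙ᵀ) ≤ A𝒫p^{|X|_k} · w_{k:k+1}^X(φ)^p`.
[cite: AdamsBuchholzKoteckyMuller2019, Lemma 8.4 (proof) / Theorem 7.1 (w7)] -/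
theorem integral_weight_rpow_multivariateGaussian_add_constMat_le (W : WeightData (Fin d → ZMod M))
    {nb : ℕ → Finset (Fin d → ZMod M) → Finset (Fin d → ZMod M)} (hWl : W.Local nb)
    {Dm : ℕ → Matrix (Fin d → ZMod M) (Fin d → ZMod M) ℝ} (hD : W.Dominated Dm)
    {𝒞 : (Fin d → ZMod M) → ℝ} (hC : (Matrix.circulant 𝒞).PosSemidef) {c : ℝ} (hc : 0 ≤ c)
    {p : ℝ} (hp : 0 < p) {L k : ℕ} {A𝒫p C₂p : ℝ}
    (hSp : StepKernelBounds W L k A𝒫p C₂p (fun x => p * 𝒞 x))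
    {X : Finset (Fin d → ZMod M)} (hX : IsPolymer (L ^ k) X) (φ : (Fin d → ZMod M) → ℝ) :
    Integrable (fun y : EuclideanSpace ℝ (Fin d → ZMod M) => W.weight k X (φ + ofLp y) ^ p)
        (multivariateGaussian 0 (Matrix.circulant 𝒞 + constMat c)) ∧
      ∫ y, W.weight k X (φ + ofLp y) ^ p ∂(multivariateGaussian 0 (Matrix.circulant 𝒞 + constMat c)) ≤
        A𝒫p ^ numBlocks (L ^ k) X * W.midWeight k X φ ^ p := by
  have hcont : Continuous fun ξ : (Fin d → ZMod M) → ℝ => W.weight k X (φ + ξ) ^ p :=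
    (continuous_weight_comp_add W k X φ).rpow_const fun _ => Or.inr hp.le
  have htr := integral_stepMeasure_eq_integral_multivariateGaussian_add_constMat hC hc
    (F := fun ξ => W.weight k X (φ + ξ) ^ p) hcont.stronglyMeasurable
    (fun ξ a => by
      show W.weight k X (φ + (ξ + fun _ => a)) ^ p = W.weight k X (φ + ξ) ^ p
      rw [← add_assoc, WeightData.weight_add_const hWl hD])
  have hscale := integral_weight_rpow_stepMeasure_eq W k X hC hp φ
  haveI := isProbabilityMeasure_stepMeasure (fun x => p * 𝒞 x)
  have hpos : 0 < ∫ η, W.weight k X (Real.sqrt p • φ + η) ∂(stepMeasure (fun x => p * 𝒞 x)) := by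
    have hi := hSp.integrable_weight hD X (Real.sqrt p • φ)
    unfold WeightData.weight at hi ⊢
    exact integral_exp_pos hi
  have hle : ∫ η, W.weight k X (Real.sqrt p • φ + η) ∂(stepMeasure (fun x => p * 𝒞 x)) ≤
      A𝒫p ^ numBlocks (L ^ k) X * W.midWeight k X φ ^ p := by
    have h := hSp.integral_stepMeasure_le hX (Real.sqrt p • φ)
    rwa [midWeight_smul, Real.sq_sqrt hp.le] at h
  constructor
  · by_contra h
    rw [← hscale, htr, integral_undef h] at hpos
    exact lt_irrefl _ hpos
  · rw [← htr, hscale]; exact hle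

/-! ## Lemma 8.4 with `ℓ = 1` in the Taylor norms -/

set_option maxHeartbeats 800000 in
/-- **[ABKM19] Lemma 8.4, `ℓ = 1` (crude, volume-dependent form): the integration map is
Lipschitz in the step kernel.**  Let `W` be local dominated weight data, `𝒞a, 𝒞b` even zero-sum
step kernels with `StepKernelBounds` at scale `k`, positive multipliers off the zero mode and
`|Re 𝒞̂a(κ) − Re 𝒞̂b(κ)| ≤ δ · Re 𝒞̂a(κ)` for all `κ`; let `p, q` be Hölder conjugate with
`0 ≤ δ ≤ 1/(16q)` and let the dilated kernel `p·𝒞b` satisfy `StepKernelBounds` with constant `A𝒫p`.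
Then for a `k`-polymer `X`, a gauge `T` killing the constants and a `T`-local `C^{r₀}` functional
`K` with `‖K‖_{T, w_k^X} ≤ C`:
`‖fluct 𝒞a K − fluct 𝒞b K‖_{T, w_{k:k+1}^X} ≤ C · ((r₀+1) · gaussCompConst(|Λ|, q) · δ · (A𝒫p^{|X|_k})^{1/p})`.
[cite: AdamsBuchholzKoteckyMuller2019, Lemma 8.4] -/
theorem tayNormLE_fluct_sub_fluct (W : WeightData (Fin d → ZMod M))
    {nb : ℕ → Finset (Fin d → ZMod M) → Finset (Fin d → ZMod M)} (hWl : W.Local nb)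
    {Dm : ℕ → Matrix (Fin d → ZMod M) (Fin d → ZMod M) ℝ} (hD : W.Dominated Dm)
    {L k : ℕ} {A𝒫a A𝒫b A𝒫p C₂a C₂b C₂p : ℝ} {𝒞a 𝒞b : (Fin d → ZMod M) → ℝ}
    (hSa : StepKernelBounds W L k A𝒫a C₂a 𝒞a) (hSb : StepKernelBounds W L k A𝒫b C₂b 𝒞b)
    {p q : ℝ} (hpq : p.HolderConjugate q)
    (hSp : StepKernelBounds W L k A𝒫p C₂p (fun x => p * 𝒞b x))
    (hea : ∀ x, 𝒞a (-x) = 𝒞a x) (heb : ∀ x, 𝒞b (-x) = 𝒞b x)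
    (h0a : ∑ x, 𝒞a x = 0) (h0b : ∑ x, 𝒞b x = 0)
    (hposa : ∀ κ, κ ≠ 0 → 0 < (fourierCoeff 𝒞a κ).re)
    (hposb : ∀ κ, κ ≠ 0 → 0 < (fourierCoeff 𝒞b κ).re)
    {δ : ℝ} (hδ0 : 0 ≤ δ) (hδq : δ ≤ 1 / (16 * q))
    (hcmp : ∀ κ, |(fourierCoeff 𝒞a κ).re - (fourierCoeff 𝒞b κ).re| ≤ δ * (fourierCoeff 𝒞a κ).re)
    {X : Finset (Fin d → ZMod M)} (hX : IsPolymer (L ^ k) X)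
    {V : Type*} [NormedAddCommGroup V] [NormedSpace ℝ V]
    (T : ((Fin d → ZMod M) → ℝ) →ₗ[ℝ] V) (hT : ∀ a : ℝ, T (fun _ => a) = 0)
    {r₀ : ℕ} {K : ((Fin d → ZMod M) → ℝ) → ℂ} {C : ℝ}
    (hC : 0 ≤ C) (hKd : ContDiff ℝ r₀ K) (hKloc : IsGaugeLocal T K)
    (hK : TayNormLE T r₀ (W.weight k X) K C) :
    TayNormLE T r₀ (W.midWeight k X) (fluct 𝒞a K - fluct 𝒞b K)
      (C * ((r₀ + 1) * gaussCompConst (Fintype.card (Fin d → ZMod M)) q * δ *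
        (A𝒫p ^ numBlocks (L ^ k) X) ^ (1 / p))) := by
  intro φ
  have hp1 : 1 < p := hpq.lt
  have hp0 : 0 < p := by linarith
  have hq0 : 0 < q := by linarith [hpq.symm.lt]
  have hpE : ENNReal.ofReal p ≠ 0 := by simp [hp0]
  set n := Fintype.card (Fin d → ZMod M) with hn
  set Kbar := gaugeLift T K with hKbar
  have hKbar_d : ContDiff ℝ r₀ Kbar := contDiff_gaugeLift T hKd
  set gcc := gaussCompConst n q with hgcc
  have hgcc0 : 0 ≤ gcc := gaussCompConst_nonneg _ hq0.le
  set Ap := A𝒫p ^ numBlocks (L ^ k) X with hAp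
  have hwm := W.midWeight_pos k X φ
  have hAp0 : 0 ≤ Ap := by
    by_contra hneg
    push Not at hneg
    have h1 := hSp.pow_mul_midWeight_nonneg hX φ
    exact absurd h1 (not_le.2 (mul_neg_of_neg_of_pos hneg hwm))
  -- the regularised covariances
  set Sa : Matrix (Fin d → ZMod M) (Fin d → ZMod M) ℝ := Matrix.circulant 𝒞a + constMat 1 with hSa_def
  set Sb : Matrix (Fin d → ZMod M) (Fin d → ZMod M) ℝ := Matrix.circulant 𝒞b + constMat 1 with hSb_def
  set νa := multivariateGaussian (0 : EuclideanSpace ℝ (Fin d → ZMod M)) Sa with hνa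
  set νb := multivariateGaussian (0 : EuclideanSpace ℝ (Fin d → ZMod M)) Sb with hνb
  have hSaPD : Sa.PosDef := posDef_circulant_add_constMat hea hposa
    (re_fourierCoeff_zero_nonneg_of_sum_eq_zero h0a) one_pos
  have hSbPD : Sb.PosDef := posDef_circulant_add_constMat heb hposb
    (re_fourierCoeff_zero_nonneg_of_sum_eq_zero h0b) one_pos
  -- the precision sandwich in Fourier variables
  have hMd : (0 : ℝ) < (M : ℝ) ^ d := pow_pos (Nat.cast_pos.2 (Nat.pos_of_ne_zero (NeZero.ne M))) d
  have hsand : ∀ v : (Fin d → ZMod M) → ℝ, |v ⬝ᵥ (Sb⁻¹ - Sa⁻¹) *ᵥ v| ≤ δ * (v ⬝ᵥ Sb⁻¹ *ᵥ v) := by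
    intro v
    rw [hSb_def, hSa_def, circulant_add_constMat_eq_mulMat heb, circulant_add_constMat_eq_mulMat hea]
    refine abs_dotProduct_mulMat_inv_sub_le
      (re_fourierCoeff_add_zeroModeMul_pos hposb (re_fourierCoeff_zero_nonneg_of_sum_eq_zero h0b) one_pos)
      (re_fourierCoeff_add_zeroModeMul_pos hposa (re_fourierCoeff_zero_nonneg_of_sum_eq_zero h0a) one_pos)
      (re_fourierCoeff_add_zeroModeMul_neg heb 1) (re_fourierCoeff_add_zeroModeMul_neg hea 1)
      (fun κ => ?_) v
    by_cases hκ : κ = 0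
    · simp only [hκ, if_true, re_fourierCoeff_zero_of_sum_eq_zero h0a,
        re_fourierCoeff_zero_of_sum_eq_zero h0b, sub_self, abs_zero, zero_add]
      positivity
    · simp only [if_neg hκ, add_zero]
      exact hcmp κ
  -- `T.rangeRestrict` kills the constants
  have hTr : ∀ a : ℝ, T.rangeRestrict (fun _ : Fin d → ZMod M => a) = 0 := fun a =>
    Subtype.ext (hT a)
  -- per-order estimate
  have hterm : ∀ s, s ≤ r₀ →
      ‖iteratedFDeriv ℝ s (gaugeLift T (fluct 𝒞a K - fluct 𝒞b K)) (T.rangeRestrict φ)‖ ≤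
        (s.factorial : ℝ) * C * (gcc * δ * Ap ^ (1 / p)) * W.midWeight k X φ := by
    intro s hs
    have hs' : (s : WithTop ℕ∞) ≤ r₀ := by exact_mod_cast hs
    set G : ((Fin d → ZMod M) → ℝ) → _ :=
      fun ζ => iteratedFDeriv ℝ s Kbar (T.rangeRestrict φ + T.rangeRestrict ζ) with hG
    -- (1) the derivative of the lift of the difference
    have hDa := hK.derivDominated_section hC hKd (hSa.weightSectionDominated hD X T)
    have hDb := hK.derivDominated_section hC hKd (hSb.weightSectionDominated hD X T)
    have hlift_a : gaugeLift T (fluct 𝒞a K) =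
        fun w => ∫ ζ, Kbar (w + T.rangeRestrict ζ) ∂(stepMeasure 𝒞a) := by
      funext w; exact gaugeLift_integral_comp_add hKloc _ w
    have hlift_b : gaugeLift T (fluct 𝒞b K) =
        fun w => ∫ ζ, Kbar (w + T.rangeRestrict ζ) ∂(stepMeasure 𝒞b) := by
      funext w; exact gaugeLift_integral_comp_add hKloc _ w
    have hDs_a : iteratedFDeriv ℝ s (gaugeLift T (fluct 𝒞a K)) (T.rangeRestrict φ) =
        ∫ ζ, G ζ ∂(stepMeasure 𝒞a) := by
      rw [hlift_a, hDa.iteratedFDeriv_integral_eq s hs]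
      refine integral_congr_ae (ae_of_all _ fun ζ => ?_)
      simp only [hG]
      rw [iteratedFDeriv_comp_add_right]
    have hDs_b : iteratedFDeriv ℝ s (gaugeLift T (fluct 𝒞b K)) (T.rangeRestrict φ) =
        ∫ ζ, G ζ ∂(stepMeasure 𝒞b) := by
      rw [hlift_b, hDb.iteratedFDeriv_integral_eq s hs]
      refine integral_congr_ae (ae_of_all _ fun ζ => ?_)
      simp only [hG]
      rw [iteratedFDeriv_comp_add_right]
    have hca : ContDiff ℝ r₀ (gaugeLift T (fluct 𝒞a K)) :=
      contDiff_gaugeLift T (hSa.contDiff_fluct hD X T hC hKd hKloc hK)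
    have hcb : ContDiff ℝ r₀ (gaugeLift T (fluct 𝒞b K)) :=
      contDiff_gaugeLift T (hSb.contDiff_fluct hD X T hC hKd hKloc hK)
    have hsub : gaugeLift T (fluct 𝒞a K - fluct 𝒞b K) =
        gaugeLift T (fluct 𝒞a K) - gaugeLift T (fluct 𝒞b K) := by
      funext w; rfl
    rw [hsub, iteratedFDeriv_sub_apply ((hca.of_le hs').contDiffAt) ((hcb.of_le hs').contDiffAt),
      hDs_a, hDs_b]
    -- (2) properties of `G`
    have hGcont : Continuous G := by
      show Continuous fun ζ => iteratedFDeriv ℝ s Kbar (T.rangeRestrict φ + gaugeRestrictCLM T ζ)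
      exact (hKbar_d.continuous_iteratedFDeriv hs').comp
        (continuous_const.add (gaugeRestrictCLM T).continuous)
    have hGinv : ∀ (ζ : (Fin d → ZMod M) → ℝ) (a : ℝ), G (ζ + fun _ => a) = G ζ := by
      intro ζ a
      simp only [hG]
      rw [map_add, hTr a, add_zero]
    have hGbound : ∀ ζ, ‖G ζ‖ ≤ (s.factorial : ℝ) * C * W.weight k X (φ + ζ) := by
      intro ζ
      have hcoef := pow_div_factorial_mul_norm_iteratedFDeriv_le_tphiSeminorm r₀ zero_le_one Kbar
        (T.rangeRestrict (φ + ζ)) hs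
      rw [one_pow, ← tayNorm_eq_tphiSeminorm] at hcoef
      have hfac : (0 : ℝ) < s.factorial := by positivity
      rw [div_mul_eq_mul_div, one_mul, div_le_iff₀ hfac] at hcoef
      have hpt : T.rangeRestrict φ + T.rangeRestrict ζ = T.rangeRestrict (φ + ζ) := (map_add _ _ _).symm
      simp only [hG]
      rw [hpt]
      calc ‖iteratedFDeriv ℝ s Kbar (T.rangeRestrict (φ + ζ))‖
          ≤ tayNorm T r₀ K (φ + ζ) * s.factorial := hcoef
        _ ≤ C * W.weight k X (φ + ζ) * s.factorial :=
            mul_le_mul_of_nonneg_right (hK _) (Nat.cast_nonneg _)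
        _ = (s.factorial : ℝ) * C * W.weight k X (φ + ζ) := by ring
    -- (3) transfer both expectations to the regularised Gaussians
    have htra : ∫ ζ, G ζ ∂(stepMeasure 𝒞a) = ∫ y, G (ofLp y) ∂νa :=
      integral_stepMeasure_eq_integral_multivariateGaussian_add_constMat hSa.posSemidef zero_le_one
        hGcont.stronglyMeasurable hGinv
    have htrb : ∫ ζ, G ζ ∂(stepMeasure 𝒞b) = ∫ y, G (ofLp y) ∂νb :=
      integral_stepMeasure_eq_integral_multivariateGaussian_add_constMat hSb.posSemidef zero_le_one
        hGcont.stronglyMeasurable hGinv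
    rw [htra, htrb]
    -- (4) the hypotheses of the Banach-valued Gaussian comparison
    have hGm : Continuous fun y : EuclideanSpace ℝ (Fin d → ZMod M) => G (ofLp y) :=
      hGcont.comp (PiLp.continuous_ofLp 2 _)
    have hwa : Integrable (fun y : EuclideanSpace ℝ (Fin d → ZMod M) => W.weight k X (φ + ofLp y)) νa :=
      integrable_weight_multivariateGaussian_add_constMat W hWl hD hSa.posSemidef zero_le_one k X
        (hSa.integrable_weight hD X) φ
    obtain ⟨hwpb_int, hwpb_le⟩ := integral_weight_rpow_multivariateGaussian_add_constMat_le W hWl hD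
      hSb.posSemidef zero_le_one hp0 hSp hX φ
    have hH₁ : Integrable (fun y : EuclideanSpace ℝ (Fin d → ZMod M) => G (ofLp y)) νa := by
      refine Integrable.mono' (hwa.const_mul ((s.factorial : ℝ) * C)) hGm.aestronglyMeasurable
        (ae_of_all _ fun y => ?_)
      exact hGbound (ofLp y)
    have hbound_p : ∀ y : EuclideanSpace ℝ (Fin d → ZMod M),
        ‖G (ofLp y)‖ ^ p ≤ ((s.factorial : ℝ) * C) ^ p * W.weight k X (φ + ofLp y) ^ p := by
      intro y
      rw [← Real.mul_rpow (by positivity) (W.weight_pos k X _).le]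
      exact Real.rpow_le_rpow (norm_nonneg _) (hGbound (ofLp y)) hp0.le
    have hnormp : Integrable (fun y : EuclideanSpace ℝ (Fin d → ZMod M) => ‖G (ofLp y)‖ ^ p) νb := by
      refine Integrable.mono' (hwpb_int.const_mul (((s.factorial : ℝ) * C) ^ p))
        (hGm.norm.rpow_const fun _ => Or.inr hp0.le).aestronglyMeasurable (ae_of_all _ fun y => ?_)
      rw [Real.norm_of_nonneg (by positivity)]
      exact hbound_p y
    have hH : MemLp (fun y : EuclideanSpace ℝ (Fin d → ZMod M) => G (ofLp y)) (ENNReal.ofReal p) νb := by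
      rw [← integrable_norm_rpow_iff hGm.aestronglyMeasurable hpE ENNReal.ofReal_ne_top,
        ENNReal.toReal_ofReal hp0.le]
      exact hnormp
    -- (5) the comparison and the `L^p` bound
    have hmain := norm_integral_multivariateGaussian_sub_le hSbPD hSaPD hδ0 hsand hpq hδq hH hH₁
    refine hmain.trans ?_
    have hLp : (∫ y, ‖G (ofLp y)‖ ^ p ∂νb) ^ (1 / p) ≤
        (s.factorial : ℝ) * C * (Ap ^ (1 / p) * W.midWeight k X φ) := by
      have h1 : ∫ y, ‖G (ofLp y)‖ ^ p ∂νb ≤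
          ((s.factorial : ℝ) * C) ^ p * (Ap * W.midWeight k X φ ^ p) := by
        calc ∫ y, ‖G (ofLp y)‖ ^ p ∂νb
            ≤ ∫ y, ((s.factorial : ℝ) * C) ^ p * W.weight k X (φ + ofLp y) ^ p ∂νb :=
              integral_mono_of_nonneg (ae_of_all _ fun y => by positivity)
                (hwpb_int.const_mul _) (ae_of_all _ fun y => hbound_p y)
          _ = ((s.factorial : ℝ) * C) ^ p * ∫ y, W.weight k X (φ + ofLp y) ^ p ∂νb :=
              integral_const_mul _ _
          _ ≤ ((s.factorial : ℝ) * C) ^ p * (Ap * W.midWeight k X φ ^ p) :=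
              mul_le_mul_of_nonneg_left hwpb_le (by positivity)
      calc (∫ y, ‖G (ofLp y)‖ ^ p ∂νb) ^ (1 / p)
          ≤ (((s.factorial : ℝ) * C) ^ p * (Ap * W.midWeight k X φ ^ p)) ^ (1 / p) :=
            Real.rpow_le_rpow (integral_nonneg fun y => by positivity) h1 (by positivity)
        _ = (s.factorial : ℝ) * C * (Ap ^ (1 / p) * W.midWeight k X φ) := by
            rw [Real.mul_rpow (by positivity) (mul_nonneg hAp0 (by positivity)),
              Real.mul_rpow hAp0 (by positivity), ← Real.rpow_mul (by positivity),
              ← Real.rpow_mul hwm.le, mul_one_div_cancel hp0.ne', Real.rpow_one, Real.rpow_one]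
    calc gcc * δ * (∫ y, ‖G (ofLp y)‖ ^ p ∂νb) ^ (1 / p)
        ≤ gcc * δ * ((s.factorial : ℝ) * C * (Ap ^ (1 / p) * W.midWeight k X φ)) :=
          mul_le_mul_of_nonneg_left hLp (mul_nonneg hgcc0 hδ0)
      _ = (s.factorial : ℝ) * C * (gcc * δ * Ap ^ (1 / p)) * W.midWeight k X φ := by ring
  -- (6) sum over the Taylor orders
  show tayNorm T r₀ (fluct 𝒞a K - fluct 𝒞b K) φ ≤ _
  unfold tayNorm
  calc ∑ s ∈ Finset.range (r₀ + 1), ((s.factorial : ℝ)⁻¹) *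
        ‖iteratedFDeriv ℝ s (gaugeLift T (fluct 𝒞a K - fluct 𝒞b K)) (T.rangeRestrict φ)‖
      ≤ ∑ _s ∈ Finset.range (r₀ + 1), C * (gcc * δ * Ap ^ (1 / p)) * W.midWeight k X φ := by
        refine sum_le_sum fun s hs => ?_
        have hs' : s ≤ r₀ := Nat.lt_succ_iff.1 (mem_range.1 hs)
        have hfac : (0 : ℝ) < s.factorial := by positivity
        calc ((s.factorial : ℝ)⁻¹) *
              ‖iteratedFDeriv ℝ s (gaugeLift T (fluct 𝒞a K - fluct 𝒞b K)) (T.rangeRestrict φ)‖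
            ≤ ((s.factorial : ℝ)⁻¹) *
                ((s.factorial : ℝ) * C * (gcc * δ * Ap ^ (1 / p)) * W.midWeight k X φ) :=
              mul_le_mul_of_nonneg_left (hterm s hs') (by positivity)
          _ = C * (gcc * δ * Ap ^ (1 / p)) * W.midWeight k X φ := by
              field_simp
    _ = C * ((r₀ + 1) * gcc * δ * Ap ^ (1 / p)) * W.midWeight k X φ := by
        rw [sum_const, card_range, nsmul_eq_mul]
        push_cast
        ring

end Literature.MathematicalPhysics.StatisticalMechanics.GradientRG

end
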